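import Summits.Ventures.QEC.Census.BZAutBBLower
import HarnessLib

/-!
# Translation-orbit label cover with per-label WITNESSES, in CHUNKS (qec-search-10 g3; the `k ≥ 14` form of type-12's
# `coverAutTabOK`, same conclusion = the `hcover` hypothesis of type-10's `bzAut_lower_sound`)

type-12's tabulated cover check `coverAutTabOK ℓ m Ld L taus blocks` (`Census/BB/BB144/OrbitBZCover.lean`) probes, for
every non-zero label `λ < 2^k`, the cover mask directly and then EVERY listed translation until one hits; for the
A.1 census codes with `k = 14…18` logical qubits and few representative blocks this is `2·10⁵ … 2·10⁶` probes in ONE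
`decide` (measured: `[[170,16,10]]`, 7 blocks, 84 translations, 1.8·10⁶ probes — the farm kills the theorem at 183 s).
Here the emitter supplies, per label, the INDEX of a translation that works (a witness; `0` = covered directly,
`i + 1` = translation `taus[i]`), so the kernel makes ONE probe per label, and the label range is cut into chunks
(one `decide +kernel` theorem per chunk, ≤ 16384 labels):

* `coverWitGo cm tabs lam wits` — labels `lam, lam+1, …` against the witness list (structural recursion on `wits`);
* `coverAutWitRangeOK ℓ m Ld L taus blocks lo wits` — the listed translations are in range and the labels
  `[lo, lo + |wits|)` pass (the chunk check the emitter `decide`s);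
* `CoverLabels ℓ m Ld L taus blocks lo hi` — the PROPERTY "every label in `[lo, hi)` is in the cover mask directly or
  after the tabulated action `xorSel (rhoCols ℓ m Ld L t) ·` of a listed translation `t`";
  `coverLabels_of_witRangeOK` (chunk ⇒ property), `CoverLabels.append` (glue), `CoverLabels.of_le` ;
* `coverAutWit_hcover` — `CoverLabels … 1 (2^k)` ⇒ EXACTLY the conclusion of type-12's `bzAut_translate_hcover`
  (`Census/BZAutBBLower.lean`), i.e. the `hcover` hypothesis of `bzAut_lower_sound` for
  `α := {t : ℤ_ℓ × ℤ_m // (t₁,t₂) ∈ taus}` and `ρ_t = LX · (LZ ∘ (translateFlat t)⁻¹)ᵀ`; so a row closer is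
  `bzAut_lower_sound hcomm hfound hcore hlen hblocks _ _ (bzAut_translate_hφ …) (coverAutWit_hcover htaus hall) w hw hw'`.

Soundness is type-12's per-label algebra verbatim (`ofBits_xorSel_rhoCols`: the tabulated probe word IS `ρ_t *ᵥ λ`;
type-10's `testBit_coverMask_imp_exists_span`: a set mask bit IS membership in a block's label span); only the Bool
driver differs. HONEST FRAMING: infrastructure; no certificate is read and no distance is asserted here. Tier KERNEL,
axioms standard. [folklore] (Brouwer–Zimmermann with automorphisms: cover of the label space by translates of the
representative blocks' label spans — Grassl 2006 §2.2; Bravyi et al. 2024 SI §9.2–9.3 for the translations.)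
-/

namespace Summit.Ventures.QEC.Census

open Matrix Literature.InformationTheory.QuantumCodes Literature.InformationTheory.QuantumCodes.BB

/-! ## The Bool driver -/

/-- One label `lam` with witness `w`: covered directly (`cm.testBit lam`), or — if `w = i + 1` and `tabs[i]` exists —
after the tabulated action of translation `i` (`cm.testBit (xorSel tabs[i] lam)`). (definition) -/
def coverWitStep (cm : ℕ) (tabs : List (List ℕ)) (lam w : ℕ) : Bool :=
  cm.testBit lam ||
    match w with
    | 0 => false
    | i + 1 =>
      match tabs[i]? with
      | some cols => cm.testBit (xorSel cols lam)
      | none => false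

/-- Labels `lam, lam + 1, …, lam + |wits| − 1` against the witness list, one probe each (structural on `wits`). (definition) -/
def coverWitGo (cm : ℕ) (tabs : List (List ℕ)) : ℕ → List ℕ → Bool
  | _, [] => true
  | lam, w :: ws => coverWitStep cm tabs lam w && coverWitGo cm tabs (lam + 1) ws

/-- **Chunk check**: every listed translation `(t₁,t₂)` has `t₁ < ℓ`, `t₂ < m`, and the labels `[lo, lo + |wits|)` pass
`coverWitGo` against the cover mask of `blocks` and the tabulated columns `rhoCols ℓ m Ld L t` of the listed
translations (computed once per chunk). (definition) -/
def coverAutWitRangeOK (ℓ m : ℕ) (Ld L : List ℕ) (taus : List (ℕ × ℕ)) (blocks : List BZBlock)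
    (lo : ℕ) (wits : List ℕ) : Bool :=
  (taus.all fun t => decide (t.1 < ℓ) && decide (t.2 < m)) &&
    coverWitGo (coverMask blocks) (taus.map fun t => rhoCols ℓ m Ld L t) lo wits

/-! ## The property and its glue -/

/-- **Labels `[lo, hi)` are covered** (a predicate on the check's inputs, not a named fact): each label is in the cover
mask directly, or after the tabulated action of some LISTED translation. (definition) [folklore] -/
def CoverLabels (ℓ m : ℕ) (Ld L : List ℕ) (taus : List (ℕ × ℕ)) (blocks : List BZBlock) (lo hi : ℕ) : Prop :=
  ∀ lam : ℕ, lo ≤ lam → lam < hi →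
    (coverMask blocks).testBit lam = true ∨
      ∃ t ∈ taus, (coverMask blocks).testBit (xorSel (rhoCols ℓ m Ld L t) lam) = true

/-- One witnessed step is a cover fact for its label. -/
theorem coverWitStep_sound {ℓ m : ℕ} {Ld L : List ℕ} {taus : List (ℕ × ℕ)} {blocks : List BZBlock} {lam w : ℕ}
    (h : coverWitStep (coverMask blocks) (taus.map fun t => rhoCols ℓ m Ld L t) lam w = true) :
    (coverMask blocks).testBit lam = true ∨
      ∃ t ∈ taus, (coverMask blocks).testBit (xorSel (rhoCols ℓ m Ld L t) lam) = true := by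
  unfold coverWitStep at h
  rcases Bool.or_eq_true_iff.1 h with hd | hw
  · exact Or.inl hd
  · cases w with
    | zero => exact absurd hw (by simp)
    | succ i =>
      simp only at hw
      cases hi : (taus.map fun t => rhoCols ℓ m Ld L t)[i]? with
      | none => rw [hi] at hw; exact absurd hw (by simp)
      | some cols =>
        rw [hi] at hw
        obtain ⟨t, ht, rfl⟩ : ∃ t ∈ taus, rhoCols ℓ m Ld L t = cols := by
          rw [List.getElem?_map] at hi
          cases hti : taus[i]? with
          | none => rw [hti] at hi; exact absurd hi (by simp)
          | some t => rw [hti] at hi; exact ⟨t, List.mem_of_getElem? hti, by simpa using hi⟩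
        exact Or.inr ⟨t, ht, hw⟩

/-- The driver is sound for its label range. -/
theorem coverWitGo_sound {ℓ m : ℕ} {Ld L : List ℕ} {taus : List (ℕ × ℕ)} {blocks : List BZBlock} :
    ∀ (wits : List ℕ) (lo : ℕ),
      coverWitGo (coverMask blocks) (taus.map fun t => rhoCols ℓ m Ld L t) lo wits = true →
        CoverLabels ℓ m Ld L taus blocks lo (lo + wits.length)
  | [], lo, _ => fun lam h1 h2 => absurd h2 (by simp; exact h1)
  | w :: ws, lo, h => by
    simp only [coverWitGo, Bool.and_eq_true] at h
    intro lam h1 h2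
    rcases Nat.eq_or_lt_of_le h1 with rfl | hlt
    · exact coverWitStep_sound h.1
    · have ih := coverWitGo_sound ws (lo + 1) h.2
      exact ih lam hlt (by simp [List.length_cons] at h2 ⊢; omega)

/-- **Chunk ⇒ property**: `coverAutWitRangeOK … lo wits` with `|wits| = len` covers `[lo, lo + len)`. -/
theorem coverLabels_of_witRangeOK {ℓ m : ℕ} {Ld L : List ℕ} {taus : List (ℕ × ℕ)} {blocks : List BZBlock}
    {lo len : ℕ} {wits : List ℕ} (h : coverAutWitRangeOK ℓ m Ld L taus blocks lo wits = true)
    (hlen : wits.length = len) : CoverLabels ℓ m Ld L taus blocks lo (lo + len) := by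
  simp only [coverAutWitRangeOK, Bool.and_eq_true] at h
  rw [← hlen]
  exact coverWitGo_sound wits lo h.2

/-- The chunk check also certifies that the listed translations are in range. -/
theorem taus_ok_of_witRangeOK {ℓ m : ℕ} {Ld L : List ℕ} {taus : List (ℕ × ℕ)} {blocks : List BZBlock}
    {lo : ℕ} {wits : List ℕ} (h : coverAutWitRangeOK ℓ m Ld L taus blocks lo wits = true) :
    (taus.all fun t => decide (t.1 < ℓ) && decide (t.2 < m)) = true := by
  simp only [coverAutWitRangeOK, Bool.and_eq_true] at h
  exact h.1

/-- Glue two adjacent ranges. -/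
theorem CoverLabels.append {ℓ m : ℕ} {Ld L : List ℕ} {taus : List (ℕ × ℕ)} {blocks : List BZBlock} {a b c : ℕ}
    (h₁ : CoverLabels ℓ m Ld L taus blocks a b) (h₂ : CoverLabels ℓ m Ld L taus blocks b c) :
    CoverLabels ℓ m Ld L taus blocks a c := fun lam ha hc => by
  rcases Nat.lt_or_ge lam b with hb | hb
  · exact h₁ lam ha hb
  · exact h₂ lam hb hc

/-- The empty range. -/
theorem CoverLabels.nil {ℓ m : ℕ} {Ld L : List ℕ} {taus : List (ℕ × ℕ)} {blocks : List BZBlock} (a : ℕ) :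
    CoverLabels ℓ m Ld L taus blocks a a := fun _ h1 h2 => absurd h2 (Nat.not_lt.2 h1)

/-! ## The `hcover` hypothesis of `bzAut_lower_sound` -/

/-- **Witnessed cover ⇒ `hcover`.** If the listed translations are in range and the labels `[1, 2^k)` (`k = |L|`) are
covered (assembled from chunk theorems by `CoverLabels.append`), then for every non-zero label `λ : 𝔽₂^k`: `λ` lies in
some block's label span, or `ρ_t λ` does for some listed translation `t`, with
`ρ_t = ldMat n L Ld · ((logVec n L ·) ∘ (translateFlat t)⁻¹)ᵀ` — VERBATIM the conclusion of type-12's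
`bzAut_translate_hcover`, hence the `hcover` input of type-10's `bzAut_lower_sound` (and of search-9's MITM twin). -/
theorem coverAutWit_hcover {ℓ m : ℕ} [NeZero ℓ] [NeZero m] {L Ld : List ℕ} {taus : List (ℕ × ℕ)}
    {blocks : List BZBlock}
    (htaus : (taus.all fun t => decide (t.1 < ℓ) && decide (t.2 < m)) = true)
    (hall : CoverLabels ℓ m Ld L taus blocks 1 (2 ^ L.length)) :
    ∀ lam : Fin L.length → ZMod 2, lam ≠ 0 →
      (∃ b : Fin blocks.length, lam ∈ Submodule.span (ZMod 2)
        (Set.range fun l : Fin (blocks[b]).W.length => ofBits L.length (blocks[b]).W[l])) ∨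
      ∃ (a : {t : Mono ℓ m // (((t.1 : Fin ℓ) : ℕ), ((t.2 : Fin m) : ℕ)) ∈ taus}) (b : Fin blocks.length),
        (ldMat (ℓ * m + ℓ * m) L Ld * (Matrix.submatrix (fun i => logVec (ℓ * m + ℓ * m) L i :
            Matrix (Fin L.length) (Fin (ℓ * m + ℓ * m)) (ZMod 2)) id (BB.translateFlat a.1).symm)ᵀ) *ᵥ lam ∈
          Submodule.span (ZMod 2) (Set.range fun l : Fin (blocks[b]).W.length => ofBits L.length (blocks[b]).W[l]) := by
  intro lam hlam
  -- the label as a word `w`, `1 ≤ w < 2^k`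
  obtain ⟨w, hwlt, rfl⟩ : ∃ w, w < 2 ^ L.length ∧ ofBits L.length w = lam :=
    ⟨toBits lam, toBits_lt lam, ofBits_toBits lam⟩
  have hw1 : 1 ≤ w := by
    rcases Nat.eq_zero_or_pos w with rfl | hp
    · exact absurd (ofBits_zero _) hlam
    · exact hp
  have hL : ∀ j : Fin L.length, (fun i => logVec (ℓ * m + ℓ * m) L i : Matrix (Fin L.length) (Fin (ℓ * m + ℓ * m)) (ZMod 2)) j =
      ofBits (ℓ * m + ℓ * m) (L.getD j 0) := fun j => by
    change ofBits (ℓ * m + ℓ * m) L[j] = ofBits (ℓ * m + ℓ * m) (L.getD j 0)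
    rw [List.getD_eq_getElem?_getD, List.getElem?_eq_getElem j.2, Option.getD_some]
    rfl
  simp only [List.all_eq_true, Bool.and_eq_true, decide_eq_true_eq] at htaus
  rcases hall w hw1 hwlt with hbit | ⟨t, ht, hbit⟩
  · exact Or.inl (testBit_coverMask_imp_exists_span _ _ hbit)
  · obtain ⟨h1, h2⟩ := htaus t ht
    obtain ⟨b, hb⟩ := testBit_coverMask_imp_exists_span L.length blocks hbit
    refine Or.inr ⟨⟨(⟨t.1, h1⟩, ⟨t.2, h2⟩), by simpa using ht⟩, b, ?_⟩
    have key := ofBits_xorSel_rhoCols (ℓ := ℓ) (m := m) (Ld := Ld) (L := L)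
      (Ld' := ldMat (ℓ * m + ℓ * m) L Ld) (L' := fun i => logVec (ℓ * m + ℓ * m) L i)
      (fun i => rfl) hL (⟨t.1, h1⟩, ⟨t.2, h2⟩) w
    simp only at key
    rw [← key]
    exact hb

/-! ## Controls (kernel `decide`) -/

/-- Control: no blocks ⇒ the one label of `k = 1` is not covered, whatever the witness says. -/
example : coverAutWitRangeOK 1 2 [3] [3] [(0, 1)] [] 1 [1] = false := by decide

/-- Control: one block spanning the label ⇒ covered directly (witness `0`). -/
example : coverAutWitRangeOK 1 2 [3] [3] [(0, 1)] [⟨[1], []⟩] 1 [0] = true := by decide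

/-- Control: a witness pointing past the translation list is rejected (no silent pass). -/
example : coverAutWitRangeOK 1 2 [3] [3] [] [] 1 [5] = false := by decide

end Summit.Ventures.QEC.Census
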